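import Summits.BirchSwinnertonDyer.BirchSwinnertonDyer.Theorems.SignedLowerHalvesKobayashiMainConjectureSmallImageOneSignSwap
import Summits.BirchSwinnertonDyer.Rank1Residual.GaloisImage.TransvectionNormalForm
import HarnessLib

/-!
# Route `SignedLowerHalves`, crux `KobayashiMainConjectureSmallImage` (item stmt-BirchSwinnertonDyer-19002):
# the one-sign swap, part 2 — the UNIT condition on the congruence constant `c` is AUTOMATIC under the
# E-side rider: an INTEGRAL Mazur–Tate congruence with `p ∣ c` forces `μ(L^+_p(E)) ≥ 1` AND `μ(L^−_p(E)) ≥ 1`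
# (cell `bsd-ssimc`, seat `bsd-line-slh-p3` gen 4; a `--supports stmt-BirchSwinnertonDyer-19002 --as helper` file)

PARTITION (cell bsd-ssimc): X7 (A7) × item 4's `a_p = 0` window pairs WITH a `p`-congruent CM partner, ALL
ranks — types-the-object-of; the crux stays OPEN; closes none; nothing booked; BSD is not proved by any of
this. THEOREMS ONLY: no definition, no named fact, nothing about any curve asserted.

Part 1 (`…SmallImageOneSignSwap.lean`, p614662) proved the card `cm-anchor-onesign`'s first rung with the
displayed congruence `hMT : ∀ n, ∃ q r, θ_n(f)·ιP − ι(c)·θ_n(f′)·ιP′ = ι(ω_n q + p r)` for a UNIT `c ∈ ℤ_p`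
(the card's want W2cw = «class-wide hMT with a UNIT c», the critic's price P1 = «the wall is a unit c»). This
file removes the word UNIT from that want, given the rider the road already displays:

* §1 `C_dvd_signed_mul_of_mazurTate_congr_of_dvd` — if the same display holds with a constant `c ∈ ℤ_p`
  DIVISIBLE by `p`, then `p ∣ L^ε_p(E)·P` in `Λ` for EVERY sign `ε` (k3-c5's kernel lemma
  `C_dvd_sub_of_isSprungPair_of_mazurTate_congr` needs no unit hypothesis; `p ∣ c` kills the partner term);
  `not_hasUnitContent_signed_of_mazurTate_congr_of_not_isUnit` — hence, for `P` of unit content (Gauss),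
  NO signed `L^ε_p(E)` has unit content: `min(μ⁺(E), μ⁻(E)) ≥ 1`.
* §2 `isUnit_of_mazurTate_congr_of_hasUnitContent` — contrapositive: the E-side rider at ANY ONE sign
  (`HasUnitContent L₀`, `IsSignedPAdicLFunction f p ε₀ L₀`) FORCES `c ∈ ℤ_pˣ`;
  `isUnit_or_forall_not_hasUnitContent_of_mazurTate_congr` — the dichotomy.
* §3 `exists_kobayashiMainConjecture_of_oneSign_of_cmPartner_intConst` — part 1's one-sign CM road
  (= `CmAnchorOneSign.OneSignCmRoad`) with the hypothesis `IsUnit c` DROPPED: an integral constant `c ∈ ℤ_p`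
  in `hMT` suffices, its unit-ness being supplied by the rider (§2). Likewise `…_of_mainConjecture_intConst`.

READING (for the card / the pen; nothing booked): under the rider the road's wall W2cw is not «a unit c» but
the EXISTENCE of an integral one-sided congruence `θ_n(f_E)·P ≡ c·θ_n(g)·P′ (mod ω_n, p)`, `c ∈ ℤ_p` — i.e.
that the partner's (canonically normalised) Mazur–Tate elements control `E`'s Néron-normalised ones
integrally; whether `c` is a unit is then decided by `E`'s own one-sign `μ`. CONDITIONAL roads, PER PAIR;
NOT a class theorem about the crux; closes nothing; BSD is not proved by any of this.

References: [GreenbergVatsal2000] §1 (8)–(9), p. 2 (1)–(2), §3 Rem. 3.4; [Pollack2003] Prop. 6.18, Cor. 5.11;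
[Sprung2017] §3.1, Cor. 4.4; [Kobayashi2003] Thm. 3.2, (3.4)–(3.6), Conjecture (p. 2); [PollackRubin2004]
Thm. (p. 448); [KuriharaPollack2007] §3.2, Problem 3.2. Card: `Cruxes/KobayashiMainConjectureSmallImage/Ideas/cm-anchor-onesign.md`.
-/

set_option autoImplicit false
set_option linter.dupNamespace false
noncomputable section

open scoped Classical MatrixGroups ModularForm BigOperators

open CongruenceSubgroup WeierstrassCurve NumberField IsDedekindDomain
  Literature.NumberTheory.EllipticCurves
  Literature.NumberTheory.EllipticCurves.ModularForms
  Literature.NumberTheory.EllipticCurves.Rank1Residual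
  Literature.NumberTheory.EllipticCurves.Rank1Residual.Typed
  Literature.NumberTheory.EllipticCurves.Kobayashi2003 ZpExtension
  Literature.NumberTheory.EllipticCurves.GreenbergVatsal2000
  Literature.NumberTheory.EllipticCurves.BDKim2009
  Literature.NumberTheory.EllipticCurves.Sprung2017
  Summit.BirchSwinnertonDyer.Rank1Residual.X1.MuLambda
  Summit.BirchSwinnertonDyer.Rank1Residual.X11a
  Summit.BirchSwinnertonDyer.Rank1Residual.Supersingular
  Summit.BirchSwinnertonDyer.BirchSwinnertonDyer.Theorems.ChromaticCongruence
  Summit.BirchSwinnertonDyer.BirchSwinnertonDyer.Theorems.SmallImageAnalyticTransfer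
  Summit.BirchSwinnertonDyer.BirchSwinnertonDyer.Theorems.SmallImageAnalyticTransferRoad
  Summit.BirchSwinnertonDyer.BirchSwinnertonDyer.Theorems.SmallImageOneSignSwap

namespace Summit.BirchSwinnertonDyer.BirchSwinnertonDyer.Theorems.SmallImageOneSignSwapIntegral

variable {p : ℕ} [hp : Fact p.Prime]

/-! ### §1 A non-unit constant kills the E-side `μ` at BOTH signs -/

/-- **`p ∣ c` in the displayed congruence ⟹ `p ∣ L^ε_p(E)·P` in `Λ`, for EVERY sign.** For `p` odd,
`E = W`, `E′ = W′` good at `p` with `a_p = 0`, newforms `f, f′` (any levels), ANY multipliers `P, P′ ∈ Λ`,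
a constant `c ∈ ℤ_p` with `p ∣ c`, and `hMT` (part 1's display, no unit hypothesis): every `L` with
`IsSignedPAdicLFunction f p ε L` satisfies `C(p) ∣ L·P`. Proof: k3-c5's
`C_dvd_sub_of_isSprungPair_of_mazurTate_congr` gives `C(p) ∣ L·P − C(c)·(L′·P′)` for both Sprung
components (= Pollack's pair at trace `0`, `isSprungPair_zero_iff`; `L` is one of them by
`IsSignedPAdicLFunction.unique`), and `C(p) ∣ C(c)`. CONDITIONAL on `hMT`; nothing asserted.
[cite: Pollack2003, Prop. 6.18 and Cor. 5.11] [cite: Sprung2017, §3.1 and Cor. 4.4]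
[cite: Kobayashi2003, Thm. 3.2 and (3.4)–(3.5) (p. 7)] -/
theorem C_dvd_signed_mul_of_mazurTate_congr_of_dvd
    {W W' : WeierstrassCurve ℚ} [W.IsElliptic] [W.IsGloballyMinimal] [W'.IsElliptic]
    [W'.IsGloballyMinimal] (hp2 : p ≠ 2)
    (hgood : W.HasGoodReductionAtPrime p) (hap : W.frobeniusTrace p = 0)
    (hgood' : W'.HasGoodReductionAtPrime p) (hap' : W'.frobeniusTrace p = 0)
    {N N' : ℕ} [NeZero N] [NeZero N'] {f : CuspForm (Gamma0 N) 2} {f' : CuspForm (Gamma0 N') 2}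
    (hf : IsNewformOf W f) (hf' : IsNewformOf W' f')
    (P P' : IwasawaAlgebra p) {c : ℤ_[p]} (hpc : (p : ℤ_[p]) ∣ c)
    (hMT : ∀ n : ℕ, ∃ q r : IwasawaAlgebra p,
      ((mazurTateElement f p n).map (algebraMap ℚ ℚ_[p]) : PowerSeries ℚ_[p]) *
            iwasawaToPowerSeries p P -
          iwasawaToPowerSeries p (PowerSeries.C c) *
            (((mazurTateElement f' p n).map (algebraMap ℚ ℚ_[p]) : PowerSeries ℚ_[p]) *
              iwasawaToPowerSeries p P') =
        iwasawaToPowerSeries p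
          (toIwasawa p (cyclotomicOmega p n) * q + PowerSeries.C (p : ℤ_[p]) * r))
    (ε : ℤˣ) {L : IwasawaAlgebra p} (hL : IsSignedPAdicLFunction f p ε L) :
    PowerSeries.C (p : ℤ_[p]) ∣ L * P := by
  obtain ⟨Lp, Lm, _, _, hodd, heven⟩ :=
    pollack_exists_plusMinusPAdicLFunction_holds (W := W) (f := f) (p := p) hp2 hf hgood hap
  obtain ⟨Lp', Lm', _, _, hodd', heven'⟩ :=
    pollack_exists_plusMinusPAdicLFunction_holds (W := W') (f := f') (p := p) hp2 hf' hgood' hap'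
  have hSP : IsSprungPair f p 0 Lp Lm := (isSprungPair_zero_iff f p Lp Lm).mpr ⟨hodd, heven⟩
  have hSP' : IsSprungPair f' p 0 Lp' Lm' := (isSprungPair_zero_iff f' p Lp' Lm').mpr ⟨hodd', heven'⟩
  have h0 : (p : ℤ) ∣ (0 : ℤ) := dvd_zero _
  obtain ⟨hs, hfl⟩ := C_dvd_sub_of_isSprungPair_of_mazurTate_congr f f' h0 h0 hSP hSP' P P' c hMT
  -- `C(p) ∣ C(c)·anything`
  have hCc : ∀ x : IwasawaAlgebra p, PowerSeries.C (p : ℤ_[p]) ∣ PowerSeries.C c * x := fun x =>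
    dvd_mul_of_dvd_left ((PowerSeries.C (R := ℤ_[p])).map_dvd hpc) x
  -- `L` is the `ε`-component
  rcases Int.units_eq_one_or ε with rfl | rfl
  · have h1 : L = Lm := hL.unique ((isSignedPAdicLFunction_one_iff f p Lm).mpr heven)
    rw [h1]
    have := dvd_add hfl (hCc (Lm' * P'))
    rwa [sub_add_cancel] at this
  · have h1 : L = Lp := hL.unique ((isSignedPAdicLFunction_neg_one_iff f p Lp).mpr hodd)
    rw [h1]
    have := dvd_add hs (hCc (Lp' * P'))
    rwa [sub_add_cancel] at this

/-- **A NON-UNIT constant in the displayed congruence kills `E`'s one-sign `μ` at BOTH signs.** In the setting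
of `C_dvd_signed_mul_of_mazurTate_congr_of_dvd` with `P` of unit content and `c ∈ ℤ_p` NOT a unit (so `p ∣ c`,
tree `GaloisImage.Transvection.p_dvd_of_not_isUnit`): no signed
`L^ε_p(E)` has unit content (`μ(L^+_p(E)) ≥ 1` and `μ(L^−_p(E)) ≥ 1`) — Gauss
(`hasUnitContent_mul_iff_of_hasUnitContent`) and `hasUnitContent_iff_not_C_dvd`. CONDITIONAL on `hMT`;
nothing asserted. [cite: GreenbergVatsal2000, p. 2, (2)] [cite: Pollack2003, Prop. 6.18 and Cor. 5.11] -/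
theorem not_hasUnitContent_signed_of_mazurTate_congr_of_not_isUnit
    {W W' : WeierstrassCurve ℚ} [W.IsElliptic] [W.IsGloballyMinimal] [W'.IsElliptic]
    [W'.IsGloballyMinimal] (hp2 : p ≠ 2)
    (hgood : W.HasGoodReductionAtPrime p) (hap : W.frobeniusTrace p = 0)
    (hgood' : W'.HasGoodReductionAtPrime p) (hap' : W'.frobeniusTrace p = 0)
    {N N' : ℕ} [NeZero N] [NeZero N'] {f : CuspForm (Gamma0 N) 2} {f' : CuspForm (Gamma0 N') 2}
    (hf : IsNewformOf W f) (hf' : IsNewformOf W' f')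
    {P : IwasawaAlgebra p} (hP : HasUnitContent P) (P' : IwasawaAlgebra p) {c : ℤ_[p]} (hc : ¬ IsUnit c)
    (hMT : ∀ n : ℕ, ∃ q r : IwasawaAlgebra p,
      ((mazurTateElement f p n).map (algebraMap ℚ ℚ_[p]) : PowerSeries ℚ_[p]) *
            iwasawaToPowerSeries p P -
          iwasawaToPowerSeries p (PowerSeries.C c) *
            (((mazurTateElement f' p n).map (algebraMap ℚ ℚ_[p]) : PowerSeries ℚ_[p]) *
              iwasawaToPowerSeries p P') =
        iwasawaToPowerSeries p
          (toIwasawa p (cyclotomicOmega p n) * q + PowerSeries.C (p : ℤ_[p]) * r))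
    (ε : ℤˣ) {L : IwasawaAlgebra p} (hL : IsSignedPAdicLFunction f p ε L) : ¬ HasUnitContent L := by
  intro hLU
  have hLP : HasUnitContent (L * P) := (hasUnitContent_mul_iff_of_hasUnitContent hP).mpr hLU
  exact (hasUnitContent_iff_not_C_dvd (L * P)).mp hLP
    (C_dvd_signed_mul_of_mazurTate_congr_of_dvd hp2 hgood hap hgood' hap' hf hf' P P'
      (Rank1Residual.GaloisImage.Transvection.p_dvd_of_not_isUnit hc) hMT ε hL)

/-! ### §2 The rider forces a unit constant -/

/-- **The E-side rider at ANY ONE sign forces the congruence constant to be a UNIT.** In the setting above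
(`P` of unit content, `c ∈ ℤ_p` arbitrary, `hMT`): if some signed `L₀ = L^{ε₀}_p(E)` has unit content, then
`c ∈ ℤ_pˣ`. So the card's want W2cw needs only an INTEGRAL constant; its unit-ness is not part of the wall
once the rider is granted. CONDITIONAL on `hMT`; nothing asserted.
[cite: GreenbergVatsal2000, p. 2, (2) and §3 Remark 3.4] [cite: Pollack2003, Prop. 6.18 and Cor. 5.11] -/
theorem isUnit_of_mazurTate_congr_of_hasUnitContent
    {W W' : WeierstrassCurve ℚ} [W.IsElliptic] [W.IsGloballyMinimal] [W'.IsElliptic]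
    [W'.IsGloballyMinimal] (hp2 : p ≠ 2)
    (hgood : W.HasGoodReductionAtPrime p) (hap : W.frobeniusTrace p = 0)
    (hgood' : W'.HasGoodReductionAtPrime p) (hap' : W'.frobeniusTrace p = 0)
    {N N' : ℕ} [NeZero N] [NeZero N'] {f : CuspForm (Gamma0 N) 2} {f' : CuspForm (Gamma0 N') 2}
    (hf : IsNewformOf W f) (hf' : IsNewformOf W' f')
    {P : IwasawaAlgebra p} (hP : HasUnitContent P) (P' : IwasawaAlgebra p) (c : ℤ_[p])
    (hMT : ∀ n : ℕ, ∃ q r : IwasawaAlgebra p,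
      ((mazurTateElement f p n).map (algebraMap ℚ ℚ_[p]) : PowerSeries ℚ_[p]) *
            iwasawaToPowerSeries p P -
          iwasawaToPowerSeries p (PowerSeries.C c) *
            (((mazurTateElement f' p n).map (algebraMap ℚ ℚ_[p]) : PowerSeries ℚ_[p]) *
              iwasawaToPowerSeries p P') =
        iwasawaToPowerSeries p
          (toIwasawa p (cyclotomicOmega p n) * q + PowerSeries.C (p : ℤ_[p]) * r))
    {ε₀ : ℤˣ} {L₀ : IwasawaAlgebra p} (hL₀ : IsSignedPAdicLFunction f p ε₀ L₀) (hL₀U : HasUnitContent L₀) :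
    IsUnit c := by
  by_contra hc
  exact not_hasUnitContent_signed_of_mazurTate_congr_of_not_isUnit hp2 hgood hap hgood' hap' hf hf' hP P'
    hc hMT ε₀ hL₀ hL₀U

/-- **Dichotomy for an integral congruence constant.** Under `hMT` with ANY `c ∈ ℤ_p` (`P` of unit content):
EITHER `c` is a unit (and then unit content of `L^ε_p` is an invariant of the congruence, part 1
`hasUnitContent_iff_of_mazurTate_congr`) OR no signed `L^ε_p(E)` has unit content. CONDITIONAL on `hMT`;
nothing asserted. [cite: GreenbergVatsal2000, p. 2, (2)] [cite: Pollack2003, Prop. 6.18 and Cor. 5.11] -/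
theorem isUnit_or_forall_not_hasUnitContent_of_mazurTate_congr
    {W W' : WeierstrassCurve ℚ} [W.IsElliptic] [W.IsGloballyMinimal] [W'.IsElliptic]
    [W'.IsGloballyMinimal] (hp2 : p ≠ 2)
    (hgood : W.HasGoodReductionAtPrime p) (hap : W.frobeniusTrace p = 0)
    (hgood' : W'.HasGoodReductionAtPrime p) (hap' : W'.frobeniusTrace p = 0)
    {N N' : ℕ} [NeZero N] [NeZero N'] {f : CuspForm (Gamma0 N) 2} {f' : CuspForm (Gamma0 N') 2}
    (hf : IsNewformOf W f) (hf' : IsNewformOf W' f')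
    {P : IwasawaAlgebra p} (hP : HasUnitContent P) (P' : IwasawaAlgebra p) (c : ℤ_[p])
    (hMT : ∀ n : ℕ, ∃ q r : IwasawaAlgebra p,
      ((mazurTateElement f p n).map (algebraMap ℚ ℚ_[p]) : PowerSeries ℚ_[p]) *
            iwasawaToPowerSeries p P -
          iwasawaToPowerSeries p (PowerSeries.C c) *
            (((mazurTateElement f' p n).map (algebraMap ℚ ℚ_[p]) : PowerSeries ℚ_[p]) *
              iwasawaToPowerSeries p P') =
        iwasawaToPowerSeries p
          (toIwasawa p (cyclotomicOmega p n) * q + PowerSeries.C (p : ℤ_[p]) * r)) :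
    IsUnit c ∨ ∀ (ε : ℤˣ) (L : IwasawaAlgebra p), IsSignedPAdicLFunction f p ε L → ¬ HasUnitContent L := by
  by_cases hc : IsUnit c
  · exact Or.inl hc
  · exact Or.inr fun ε L hL =>
      not_hasUnitContent_signed_of_mazurTate_congr_of_not_isUnit hp2 hgood hap hgood' hap' hf hf' hP P' hc
        hMT ε hL

/-! ### §3 The one-sign roads with an INTEGRAL congruence constant -/

/-- **One-sign road, general partner, integral constant**: part 1's
`kobayashiMainConjecture_of_oneSign_of_mazurTate_congr_of_mainConjecture` with the hypothesis `IsUnit c`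
DROPPED — `c ∈ ℤ_p` arbitrary in `hMT`; the rider at `ε₀` makes it a unit (§2, `P = ∏_{S₀} 𝒫_ℓ` of unit
content by `hasUnitContent_and_lam_eulerFactorProduct`). Conclusion `KobayashiMainConjecture W p ε₀` from the
partner's main conjecture at `ε₀`. PER PAIR; CONDITIONAL on `hMT`; closes nothing.
[cite: GreenbergVatsal2000, Thm. (1.4), §1 (8)–(9) and §3 Remark 3.4] [cite: Kobayashi2003, Thm. 1.2, Thm. 4.1 (p. 8) and Conjecture (p. 2)]
[cite: BDKim2009, Cor. 2.13, Cor. 2.5 and Prop. 2.6 (pp. 185–187)] -/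
theorem kobayashiMainConjecture_of_oneSign_of_mazurTate_congr_of_mainConjecture_intConst
    {W : WeierstrassCurve ℚ} [W.IsElliptic] [W.IsGloballyMinimal]
    (h12 : Kobayashi2003.thm12_signedSelmerDual_finite_torsion)
    (h41 : Kobayashi2003.thm41_signedCharIdeal_divisibility)
    (h5 : realPeriodRat_eq_unit_mul_plusPeriod) (h3 : realPeriodRat_eq_unit_mul_plusPeriod_three)
    (h09 : cor213_signedMu_eq_zero_iff_of_torsionIso)
    (hKim : BDKim2009.cor213_signedLambda_add_sum_delta_eq_of_torsionIso)
    (hmod : nonempty_modularParametrizationData)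
    (hp2 : p ≠ 2) (hgood : W.HasGoodReductionAtPrime p) (hap : W.frobeniusTrace p = 0)
    [NeZero (W.conductorNorm ℤ)] {f₀ : CuspForm (Gamma0 (W.conductorNorm ℤ)) 2} (hf₀ : IsNewformOf W f₀)
    {ε₀ : ℤˣ} {L₀ : IwasawaAlgebra p} (hL₀ : IsSignedPAdicLFunction f₀ p ε₀ L₀) (hL₀U : HasUnitContent L₀)
    {W' : WeierstrassCurve ℚ} [W'.IsElliptic] [W'.IsGloballyMinimal]
    (hgood' : W'.HasGoodReductionAtPrime p) (hap' : W'.frobeniusTrace p = 0)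
    (he : ∃ e : geomTorsion W (p : ℤ) ≃+ geomTorsion W' (p : ℤ),
      ∀ (σ : Field.absoluteGaloisGroup ℚ) (P : geomTorsion W (p : ℤ)), e (σ • P) = σ • e P)
    [NeZero (W'.conductorNorm ℤ)] {f₀' : CuspForm (Gamma0 (W'.conductorNorm ℤ)) 2}
    (hf₀' : IsNewformOf W' f₀') (hMC' : KobayashiMainConjecture W' p ε₀)
    (S₀ : Finset (HeightOneSpectrum (𝓞 ℚ))) (hS₀ : ∀ v ∈ S₀, ((p : ℕ) : 𝓞 ℚ) ∉ v.asIdeal)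
    (hS₀W : ∀ v : HeightOneSpectrum (𝓞 ℚ), ¬ W.HasGoodReductionAt v → v ∈ S₀)
    (hS₀W' : ∀ v : HeightOneSpectrum (𝓞 ℚ), ¬ W'.HasGoodReductionAt v → v ∈ S₀)
    (c : ℤ_[p])
    (hMT : ∀ n : ℕ, ∃ q r : IwasawaAlgebra p,
      ((mazurTateElement f₀ p n).map (algebraMap ℚ ℚ_[p]) : PowerSeries ℚ_[p]) *
            iwasawaToPowerSeries p (eulerFactorProduct W p S₀) -
          iwasawaToPowerSeries p (PowerSeries.C c) *
            (((mazurTateElement f₀' p n).map (algebraMap ℚ ℚ_[p]) : PowerSeries ℚ_[p]) *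
              iwasawaToPowerSeries p (eulerFactorProduct W' p S₀)) =
        iwasawaToPowerSeries p
          (toIwasawa p (cyclotomicOmega p n) * q + PowerSeries.C (p : ℤ_[p]) * r)) :
    KobayashiMainConjecture W p ε₀ :=
  kobayashiMainConjecture_of_oneSign_of_mazurTate_congr_of_mainConjecture h12 h41 h5 h3 h09 hKim hmod hp2
    hgood hap hf₀ hL₀ hL₀U hgood' hap' he hf₀' hMC' S₀ hS₀ hS₀W hS₀W'
    (isUnit_of_mazurTate_congr_of_hasUnitContent hp2 hgood hap hgood' hap' hf₀ hf₀'
      (hasUnitContent_and_lam_eulerFactorProduct W hp2 S₀ hS₀).1 _ c hMT hL₀ hL₀U)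
    hMT

/-- **ONE-SIGN CM ROAD with an INTEGRAL congruence constant = `CmAnchorOneSign.OneSignCmRoad` minus the
hypothesis `IsUnit c`.** From the published inputs BY NAME, `p` odd good with `a_p(E) = 0`, the
conductor-level newform `f₀`, the E-SIDE RIDER `∃ ε₀ L₀, IsSignedPAdicLFunction f₀ p ε₀ L₀ ∧ HasUnitContent L₀`,
a CM partner `W′` (`HasCM`, `GoodSS`, `a_p = 0`, `Γ_ℚ`-iso `W[p] ≃ W′[p]`), `f₀′`, `S₀ ∌ p` containing the bad
places of both, a constant `c ∈ ℤ_p` (NO unit hypothesis) and the displayed congruence `hMT`: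
`∃ ε, KobayashiMainConjecture W p ε`. PER PAIR; CONDITIONAL on `hMT` and the rider; NOT a class theorem
about the crux; closes nothing. [cite: PollackRubin2004, Theorem (p. 448) = Thm. 7.3]
[cite: GreenbergVatsal2000, Thm. (1.4) and §3 Remark 3.4] [cite: Kobayashi2003, Thm. 4.1 (p. 8) and Conjecture (p. 2)]
[cite: BDKim2009, Cor. 2.13 (p. 187)] -/
theorem exists_kobayashiMainConjecture_of_oneSign_of_cmPartner_intConst
    (h12 : Kobayashi2003.thm12_signedSelmerDual_finite_torsion)
    (h41 : Kobayashi2003.thm41_signedCharIdeal_divisibility)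
    (h5 : realPeriodRat_eq_unit_mul_plusPeriod) (h3 : realPeriodRat_eq_unit_mul_plusPeriod_three)
    (h09 : cor213_signedMu_eq_zero_iff_of_torsionIso)
    (hKim : BDKim2009.cor213_signedLambda_add_sum_delta_eq_of_torsionIso)
    (hPR : PollackRubin2004.mainTheorem_signedCharIdeal_eq_of_cm)
    (hmod : nonempty_modularParametrizationData)
    (p : ℕ) [Fact p.Prime] (W : WeierstrassCurve ℚ) [W.IsElliptic] [W.IsGloballyMinimal]
    (hp2 : p ≠ 2) (hgood : W.HasGoodReductionAtPrime p) (hap : W.frobeniusTrace p = 0)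
    [NeZero (W.conductorNorm ℤ)] (f₀ : CuspForm (Gamma0 (W.conductorNorm ℤ)) 2) (hf₀ : IsNewformOf W f₀)
    (hrider : ∃ (ε₀ : ℤˣ) (L₀ : IwasawaAlgebra p), IsSignedPAdicLFunction f₀ p ε₀ L₀ ∧ HasUnitContent L₀)
    (W' : WeierstrassCurve ℚ) [W'.IsElliptic] [W'.IsGloballyMinimal]
    (hcm' : W'.HasCM) (hss' : GoodSS W' p) (hap' : W'.frobeniusTrace p = 0)
    (he : ∃ e : geomTorsion W (p : ℤ) ≃+ geomTorsion W' (p : ℤ),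
      ∀ (σ : Field.absoluteGaloisGroup ℚ) (P : geomTorsion W (p : ℤ)), e (σ • P) = σ • e P)
    [NeZero (W'.conductorNorm ℤ)] (f₀' : CuspForm (Gamma0 (W'.conductorNorm ℤ)) 2)
    (hf₀' : IsNewformOf W' f₀')
    (S₀ : Finset (HeightOneSpectrum (𝓞 ℚ))) (hS₀ : ∀ v ∈ S₀, ((p : ℕ) : 𝓞 ℚ) ∉ v.asIdeal)
    (hS₀W : ∀ v : HeightOneSpectrum (𝓞 ℚ), ¬ W.HasGoodReductionAt v → v ∈ S₀)
    (hS₀W' : ∀ v : HeightOneSpectrum (𝓞 ℚ), ¬ W'.HasGoodReductionAt v → v ∈ S₀)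
    (c : ℤ_[p])
    (hMT : ∀ n : ℕ, ∃ q r : IwasawaAlgebra p,
      ((mazurTateElement f₀ p n).map (algebraMap ℚ ℚ_[p]) : PowerSeries ℚ_[p]) *
            iwasawaToPowerSeries p (eulerFactorProduct W p S₀) -
          iwasawaToPowerSeries p (PowerSeries.C c) *
            (((mazurTateElement f₀' p n).map (algebraMap ℚ ℚ_[p]) : PowerSeries ℚ_[p]) *
              iwasawaToPowerSeries p (eulerFactorProduct W' p S₀)) =
        iwasawaToPowerSeries p
          (toIwasawa p (cyclotomicOmega p n) * q + PowerSeries.C (p : ℤ_[p]) * r)) :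
    ∃ ε : ℤˣ, KobayashiMainConjecture W p ε := by
  obtain ⟨ε₀, L₀, hL₀, hL₀U⟩ := hrider
  have hc : IsUnit c :=
    isUnit_of_mazurTate_congr_of_hasUnitContent hp2 hgood hap hss'.1 hap' hf₀ hf₀'
      (hasUnitContent_and_lam_eulerFactorProduct W hp2 S₀ hS₀).1 _ c hMT hL₀ hL₀U
  exact exists_kobayashiMainConjecture_of_oneSign_of_cmPartner h12 h41 h5 h3 h09 hKim hPR hmod p W hp2 hgood
    hap f₀ hf₀ ⟨ε₀, L₀, hL₀, hL₀U⟩ W' hcm' hss' hap' he f₀' hf₀' S₀ hS₀ hS₀W hS₀W' c hc hMT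

end Summit.BirchSwinnertonDyer.BirchSwinnertonDyer.Theorems.SmallImageOneSignSwapIntegral

end
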